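import Summits.ValiantsHypothesis.ValiantsHypothesis.Theorems.LacunarySymmetroidMatrixDescartesVSQLaw
import Summits.ValiantsHypothesis.ValiantsHypothesis.Theorems.KPlusLogSqLawTropicalBTwoRowFamily

/-!
# The symmetric `m = 2` row attains the full (general) tropical capacity `T(2,K) = 4K − 7` for every `K` (bookkeeping)

HONEST FRAMING.  Helper file (seat val-v1x-eng-6 g3, cell `val-V1-extremal`, 2026-08-29; `--supports` the crux item
stmt-ValiantsHypothesis-18050 as a helper, no closure claim).  Two tree theorems of different seats are put side by side:

* `KPlusLogSqLaw.tropRootLawAt_two_iff` (val-sym-trop lineage): the tropical census row at `m = 2` is EXACT,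
  `TropRootLawAt 2 K B ↔ 4K − 7 ≤ B` (`K ≥ 3`) — general (not necessarily symmetric) sign/dominance designs have at most, and some
  have exactly, `4K − 7` alternations;
* `VSQ.vsq_law` (this lineage, g2): `¬ PosRootLawAt 2 K (4K − 8)` (`K ≥ 4`) — explicit real SYMMETRIC pencils with `4K − 7` distinct
  positive determinant roots («Viro patchworking + square splitting»).

Consequences recorded here: `not_posRootLawAt_two_of_not_tropRootLawAt` — at `m = 2` every bound that fails tropically fails for real
symmetric pencils too (lower-bound lifting with excess `0`, ALL `K ≥ 4`, inside the symmetric class — the tree's general lifting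
`KPlusLogSqLaw.RealDoubling.not_posRootLawAt_double_of_not_tropRootLawAt` needs size `2m`); `tropRootLawAt_two_of_posRootLawAt` (contrapositive);
`vsq_value_eq_tropical_capacity` (the three facts `¬ PosRootLawAt 2 K (4K−8)`, `TropRootLawAt 2 K (4K−7)`, `¬ TropRootLawAt 2 K (4K−8)`
together).  READING (numbers): the symmetric real row of record exceeds `4K − 7` only at `K = 5, 6, 7` (`14, 18, 22`, by `+1`, graft /
cancellation designs) and equals it from `K = 8` on as far as certified (`25`; `4K − 7` for `K = 9 … 25`); so at `m = 2` square splitting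
exactly compensates the symmetry constraint against general tropical designs, and every excess of the real census over `4K − 7` is a
non-tropical (cancellation) phenomenon — cf. the general-class excess `+3` at `(2,6)` (`KPlusLogSqLaw.GeneralExcess`).  Nothing here bears on
`MatrixDescartes` (stmt-18050) or `VP ≠ VNP`; VP ≠ VNP is NOT proved.

[folklore] monotonicity of the row predicates; bookkeeping.
-/

-- `Summit.ValiantsHypothesis.ValiantsHypothesis.…` repeats a component by the D-0017 layout
-- (single-conjunct summit), which the `dupNamespace` linter flags; the name is mandated.
set_option linter.dupNamespace false
set_option autoImplicit false

namespace Summit.ValiantsHypothesis.ValiantsHypothesis.Theorems.LacunarySymmetroidMatrixDescartes.VSQ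

open Summit.ValiantsHypothesis.ValiantsHypothesis.Theorems.MatrixDescartes.Negative (PosRootLawAt)
open Summit.ValiantsHypothesis.ValiantsHypothesis.Theorems.LacunarySymmetroidMatrixDescartes.TropicalCensus (TropRootLawAt)

/-- **Lower-bound lifting with excess `0` at `m = 2`, all `K ≥ 4`, inside the symmetric class**: a bound `B` that some general tropical
`(2,K)` design violates is violated by a real symmetric `(2,K)` pencil as well. [folklore] -/
theorem not_posRootLawAt_two_of_not_tropRootLawAt (K : ℕ) (hK : 4 ≤ K) {B : ℕ} (h : ¬ TropRootLawAt 2 K B) :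
    ¬ PosRootLawAt 2 K B := by
  have hB : B ≤ 4 * K - 8 := by
    by_contra hB
    exact h ((KPlusLogSqLaw.tropRootLawAt_two_iff K (by omega) B).2 (by omega))
  exact fun hlaw => vsq_law K hK (fun d S hS => (hlaw d S hS).trans hB)

/-- Contrapositive: every bound valid for all real symmetric `(2,K)` pencils (`K ≥ 4`) is valid for all `(2,K)` tropical designs. [folklore] -/
theorem tropRootLawAt_two_of_posRootLawAt (K : ℕ) (hK : 4 ≤ K) {B : ℕ} (h : PosRootLawAt 2 K B) : TropRootLawAt 2 K B := by
  by_contra ht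
  exact not_posRootLawAt_two_of_not_tropRootLawAt K hK ht h

/-- **The VSQ value is the tropical capacity**: for `K ≥ 4`, `ζ_sym(2,K) ≥ 4K − 7 = T(2,K)` — the three kernel facts side by side. [folklore] -/
theorem vsq_value_eq_tropical_capacity (K : ℕ) (hK : 4 ≤ K) :
    ¬ PosRootLawAt 2 K (4 * K - 8) ∧ TropRootLawAt 2 K (4 * K - 7) ∧ ¬ TropRootLawAt 2 K (4 * K - 8) :=
  ⟨vsq_law K hK, (KPlusLogSqLaw.tropRootLawAt_two_iff K (by omega) _).2 le_rfl,
    KPlusLogSqLaw.not_tropRootLawAt_two_sharp K (by omega)⟩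

end Summit.ValiantsHypothesis.ValiantsHypothesis.Theorems.LacunarySymmetroidMatrixDescartes.VSQ
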